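/-
Copyright (c) 2026 the pub-hodgecm-mathlib formalisation cell (harness21).  Prover seat hodgecm-mathlib-K2Liu-p05 (g0): Track B «K2-LIT»,
#184♮ = hLiu418 = stmt-HodgeConjecture-24832; socket #32d∕#32dR `sig_K2LiuDoublingHeightDecayLocal(R2)` of `Cruxes/HLiu418/Lines/K2_Liu_CurveThetaSigs_U5d_ZetaS.lean`
— organ (D) of the split finite slice, step 1: the explicit Iwasawa decomposition at a BAD split place too; K2/STATUS 2026-09-04 (K2Liu-p05 (g0)).
Adapted from ★ `K2LiuSplitCartanIwasawa` (K2Liu-p04): same construction, conclusion `k_w ∈ GL_{2n}(𝒪_w)` instead of `k ∈ H(𝒪_v)`.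
-/
import Summits.HodgeConjecture.HodgeConjecture.Theorems.K2LiuSplitCartanIwasawa
import HarnessLib

/-!
# The explicit Iwasawa decomposition `ι_v(t, 1) = p · k` at ANY split place (organ (D) of #32d∕#32dR, step 1)

Cell `hodgecm-mathlib`, crux item hLiu418 = `stmt-HodgeConjecture-24832`; squad K2 ∕ K2Liu, LEAD F0P6-plan (g10), prover K2Liu-p05 (g0).  THEOREMS ONLY
(no `def` ∕ instance ∕ notation ∕ named-fact hypothesis ∕ `sorry`, default heartbeats); lane `--supports stmt-HodgeConjecture-24832 --as helper`.

★ `K2LiuSplitCartanIwasawa.exists_isSiegelDelta_mul_localInt_of_diagonal` (K2Liu-p04) writes, at a split place `v` (`w ∣ v`, `c w ≠ w`) and for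
`h ∈ H(F_v)` with `h_w = reindex e₂ (diag(a) ⊕ 1)`, an EXPLICIT `h = p · k` with `p ∈ P_Δ(F_v)`, `det_Δ(p_w) = ∏_{|a_j| ≤ 1} a_j`,
`c_*(det_Δ(p_{c⁻¹w})) = (∏_{|a_j| > 1} a_j)⁻¹` and `k ∈ K_{H,v} = H(𝒪_v)` — the last clause under the GOOD-PLACE hypotheses `hTw`, `hTwd`
(`T₀ ∈ GL_n(𝒪_w)`), which its proof uses ONLY there.  The finite slices of #32d∕#32dR live at the places `v ∈ S`, typically BAD; for the height decay
what matters is that `k` ranges in SOME compact set, and `k_w ∈ GL_{2n}(𝒪_w)` (`k` in the compact `splitEquivD⁻¹ GL_{2n}(𝒪_w)`) holds at every split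
place.  `exists_isSiegelDelta_mul_glInt_of_diagonal` is that statement (the proof is p04's, verbatim up to the one clause).
[Li1992, §3 Thm. 3.1]; [GelbartPiatetskishapiroRallis1987, Part A §6]; [Kudla1994, §3]; [HarrisKudlaSweet1996, §1 (1.15)].
HONEST LABEL.  Count-neutral helper: `HC_CM` is proved only modulo the 7 printed citations (2 remaining named inputs: hLiu418 = `stmt-HodgeConjecture-24832`,
h413 = `stmt-HodgeConjecture-24833`) until rung 0 closes.
-/

set_option autoImplicit false

set_option linter.dupNamespace false

noncomputable section

open NumberField IsDedekindDomain Matrix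

namespace Summit.HodgeConjecture.HodgeConjecture.Cruxes.HLiu418.K2LiuSplitCartanIwasawaGL

open Summit.HodgeConjecture.HodgeConjecture.Cruxes.HLiu418.K2LiuSplitCartanIwasawa

open Literature.NumberTheory.Automorphic Literature.NumberTheory.Automorphic.UnitaryGroup
open Literature.NumberTheory.Automorphic.IntegralReduction
open Literature.NumberTheory.GelbartRogawski1991.AdaptedBlocks
open Literature.NumberTheory.GelbartRogawski1991.UnitaryDualPair.LocalSplitting

variable (F : Type) [Field F] [NumberField F] (E : Type) [Field E] [NumberField E] [Algebra F E]
  [Algebra.IsQuadraticExtension F E] (c : E ≃ₐ[F] E)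
  {δ : E} (hcδ : c δ = -δ) (hδ : δ ≠ 0) {d : F} (hd : δ * δ = algebraMap F E d)
  (v : HeightOneSpectrum (𝓞 F)) (n : ℕ) {T₀ : Matrix (Fin n) (Fin n) F} (hT₀ : T₀.IsSymm) (hT₀d : IsUnit T₀.det)
  {JD : Matrix (Fin (n + n)) (Fin (n + n)) E} (hJD : JD = (gramD F n T₀).map (algebraMap F E))
  (w : PlacesOver E v) (hw : c • w.1 ≠ w.1)

include hT₀d hw in
/-- **explicit Iwasawa decomposition of a diagonal Cartan element at a split place, with `det_Δ` at both places.**  For `h ∈ H(F_v)` with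
`h_w = reindex e₂ (diag(a) ⊕ 1)`, `a_j ≠ 0`: `h = p · k` with `p ∈ P_Δ(F_v)`, `k ∈ K_{H,v}`, `det_Δ(p_w) = ∏_{|a_j| ≤ 1} a_j` and
`c_*(det_Δ(p_{c⁻¹ w})) = (∏_{|a_j| > 1} a_j)⁻¹`. [cite: Li1992, §3 Thm. 3.1] [cite: GelbartPiatetskishapiroRallis1987, Part A §6] [cite: Kudla1994, §3] -/
theorem exists_isSiegelDelta_mul_glInt_of_diagonal (a : Fin n → w.1.adicCompletion E) (ha : ∀ j, a j ≠ 0)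
    (h : UnitaryGroup.localPi E c (n + n) JD v)
    (hh : (((h : UnitaryGroup.LocalGLPi E (n + n) v) w : GL (Fin (n + n)) (w.1.adicCompletion E)) :
        Matrix (Fin (n + n)) (Fin (n + n)) (w.1.adicCompletion E)) =
      Matrix.reindex (e₂ n) (e₂ n) (Matrix.fromBlocks (diagonal a) 0 0 1)) :
    ∃ p k : UnitaryGroup.localPi E c (n + n) JD v,
      IsSiegelDelta F E c hcδ hδ hd v n hT₀ hJD p ∧
        splitEquivD F E c hcδ hδ v n hT₀ hT₀d hJD w hw k ∈ glInt (n + n) (w.1.adicCompletion E) ∧ h = p * k ∧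
        detDelta F E c v n w p =
          ∏ j, (if ValuativeRel.valuation (w.1.adicCompletion E) (a j) ≤ 1 then a j else 1) ∧
        galAdicCompletionMap c (smul_inv_smul c w.1) (detDelta F E c v n (PlacesOver.galInv c w) p) =
          (∏ j, (if ValuativeRel.valuation (w.1.adicCompletion E) (a j) ≤ 1 then 1 else a j))⁻¹ := by
  -- shorthand `s j` ⇔ `|a_j|_w ≤ 1`; the blocks of `p`, `p⁻¹`, `k`, `k⁻¹` in the tree's `(inl, inr)` coordinates
  let s : Fin n → Prop := fun j => ValuativeRel.valuation (w.1.adicCompletion E) (a j) ≤ 1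
  let p₁₁ : Fin n → w.1.adicCompletion E := fun j => if s j then 0 else a j
  let p₁₂ : Fin n → w.1.adicCompletion E := fun j => if s j then a j else 1 - a j
  let p₂₁ : Fin n → w.1.adicCompletion E := fun j => if s j then -1 else 0
  let p₂₂ : Fin n → w.1.adicCompletion E := fun j => if s j then a j + 1 else 1
  let q₁₁ : Fin n → w.1.adicCompletion E := fun j => if s j then (a j + 1) * (a j)⁻¹ else (a j)⁻¹
  let q₁₂ : Fin n → w.1.adicCompletion E := fun j => if s j then -1 else -((1 - a j) * (a j)⁻¹)
  let q₂₁ : Fin n → w.1.adicCompletion E := fun j => if s j then (a j)⁻¹ else 0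
  let q₂₂ : Fin n → w.1.adicCompletion E := fun j => if s j then 0 else 1
  let k₁₁ : Fin n → w.1.adicCompletion E := fun j => if s j then a j + 1 else 1
  let k₁₂ : Fin n → w.1.adicCompletion E := fun j => if s j then -1 else 1 - (a j)⁻¹
  let k₂₁ : Fin n → w.1.adicCompletion E := fun j => if s j then 1 else 0
  let k₂₂ : Fin n → w.1.adicCompletion E := fun j => if s j then 0 else 1
  let l₁₁ : Fin n → w.1.adicCompletion E := fun j => if s j then 0 else 1
  let l₁₂ : Fin n → w.1.adicCompletion E := fun j => if s j then 1 else -(1 - (a j)⁻¹)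
  let l₂₁ : Fin n → w.1.adicCompletion E := fun j => if s j then -1 else 0
  let l₂₂ : Fin n → w.1.adicCompletion E := fun j => if s j then a j + 1 else 1
  let Pm : Matrix (Fin (n + n)) (Fin (n + n)) (w.1.adicCompletion E) :=
    Matrix.reindex (e₂ n) (e₂ n) (Matrix.fromBlocks (diagonal p₁₁) (diagonal p₁₂) (diagonal p₂₁) (diagonal p₂₂))
  let Qm : Matrix (Fin (n + n)) (Fin (n + n)) (w.1.adicCompletion E) :=
    Matrix.reindex (e₂ n) (e₂ n) (Matrix.fromBlocks (diagonal q₁₁) (diagonal q₁₂) (diagonal q₂₁) (diagonal q₂₂))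
  let Km : Matrix (Fin (n + n)) (Fin (n + n)) (w.1.adicCompletion E) :=
    Matrix.reindex (e₂ n) (e₂ n) (Matrix.fromBlocks (diagonal k₁₁) (diagonal k₁₂) (diagonal k₂₁) (diagonal k₂₂))
  let Lm : Matrix (Fin (n + n)) (Fin (n + n)) (w.1.adicCompletion E) :=
    Matrix.reindex (e₂ n) (e₂ n) (Matrix.fromBlocks (diagonal l₁₁) (diagonal l₁₂) (diagonal l₂₁) (diagonal l₂₂))
  -- `P · P⁻¹ = 1`, `K · K⁻¹ = 1`, `P · K = diag(a) ⊕ 1`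
  have hPQ : Pm * Qm = 1 := by
    simp only [Pm, Qm, reindex_fromBlocks_diagonal_mul]
    refine reindex_fromBlocks_diagonal_eq_one n ?_ ?_ ?_ ?_ <;> funext j <;>
      simp only [Pi.add_apply, Pi.mul_apply, p₁₁, p₁₂, p₂₁, p₂₂, q₁₁, q₁₂, q₂₁, q₂₂] <;> split_ifs <;> field_simp [ha j] <;> ring
  have hKL : Km * Lm = 1 := by
    simp only [Km, Lm, reindex_fromBlocks_diagonal_mul]
    refine reindex_fromBlocks_diagonal_eq_one n ?_ ?_ ?_ ?_ <;> funext j <;>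
      simp only [Pi.add_apply, Pi.mul_apply, k₁₁, k₁₂, k₂₁, k₂₂, l₁₁, l₁₂, l₂₁, l₂₂] <;> split_ifs <;> ring
  have hPK : Pm * Km = Matrix.reindex (e₂ n) (e₂ n) (Matrix.fromBlocks (diagonal a) 0 0 1) := by
    simp only [Pm, Km, reindex_fromBlocks_diagonal_mul]
    have e11 : p₁₁ * k₁₁ + p₁₂ * k₂₁ = a := by
      funext j; simp only [Pi.add_apply, Pi.mul_apply, p₁₁, p₁₂, k₁₁, k₂₁]; split_ifs <;> ring
    have e12 : p₁₁ * k₁₂ + p₁₂ * k₂₂ = fun _ => 0 := by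
      funext j; simp only [Pi.add_apply, Pi.mul_apply, p₁₁, p₁₂, k₁₂, k₂₂]; split_ifs <;> field_simp [ha j] <;> ring
    have e21 : p₂₁ * k₁₁ + p₂₂ * k₂₁ = fun _ => 0 := by
      funext j; simp only [Pi.add_apply, Pi.mul_apply, p₂₁, p₂₂, k₁₁, k₂₁]; split_ifs <;> ring
    have e22 : p₂₁ * k₁₂ + p₂₂ * k₂₂ = fun _ => 1 := by
      funext j; simp only [Pi.add_apply, Pi.mul_apply, p₂₁, p₂₂, k₁₂, k₂₂]; split_ifs <;> ring
    rw [e11, e12, e21, e22, diagonal_zero, diagonal_one]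
  -- the `GL` elements and the unitary elements
  let Pgl : GL (Fin (n + n)) (w.1.adicCompletion E) := ⟨Pm, Qm, hPQ, mul_eq_one_comm.1 hPQ⟩
  let Kgl : GL (Fin (n + n)) (w.1.adicCompletion E) := ⟨Km, Lm, hKL, mul_eq_one_comm.1 hKL⟩
  have hhw : ((h : UnitaryGroup.LocalGLPi E (n + n) v) w) = Pgl * Kgl := Units.ext (by rw [hh, Units.val_mul]; exact hPK.symm)
  let eD := splitEquivD F E c hcδ hδ v n hT₀ hT₀d hJD w hw
  have hmatW : matW F E c v n w (eD.symm Pgl) = Matrix.fromBlocks (diagonal p₁₁) (diagonal p₁₂) (diagonal p₂₁) (diagonal p₂₂) := by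
    simp only [matW, eD, splitEquivD_symm_apply_w]
    exact reindex_symm_reindex n _
  have hC : blkC (matW F E c v n w (eD.symm Pgl)) = 0 := by
    rw [hmatW, blkC_eq_zero_iff]
    simp only [Matrix.toBlocks_fromBlocks₁₁, Matrix.toBlocks_fromBlocks₁₂, Matrix.toBlocks_fromBlocks₂₁, Matrix.toBlocks_fromBlocks₂₂,
      diagonal_add]
    congr 1; funext j; simp only [p₁₁, p₁₂, p₂₁, p₂₂]; split_ifs <;> ring
  have hp : IsSiegelDelta F E c hcδ hδ hd v n hT₀ hJD (eD.symm Pgl) := isSiegelDelta_of_blkC_matW_eq_zero F E c hcδ hδ hd v n hT₀ hT₀d hJD w hw hC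
  refine ⟨eD.symm Pgl, eD.symm Kgl, hp, ?_, ?_, ?_, ?_⟩
  · -- `k_w ∈ GL_{2n}(𝒪_w)`: integral entries of `k_w` and `k_w⁻¹`
    rw [ContinuousMulEquiv.apply_symm_apply]
    refine mem_glInt_of_valBound F E v n w ?_ ?_
    · refine valBound_reindex_fromBlocks_diagonal F E v n w ?_ ?_ ?_ ?_ <;> intro j <;> simp only [k₁₁, k₁₂, k₂₁, k₂₂] <;> split_ifs with hj
      · exact Valuation.map_add_le _ hj (by rw [Valuation.map_one])
      · rw [Valuation.map_one]
      · rw [Valuation.map_neg, Valuation.map_one]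
      · refine Valuation.map_sub_le _ (by rw [Valuation.map_one]) ?_
        rw [map_inv₀, inv_le_one₀ ((Valuation.pos_iff _).2 (ha j))]; exact (not_le.1 hj).le
      · rw [Valuation.map_one]
      · rw [Valuation.map_zero]; exact zero_le
      · rw [Valuation.map_zero]; exact zero_le
      · rw [Valuation.map_one]
    · show ValBound 1 Lm
      refine valBound_reindex_fromBlocks_diagonal F E v n w ?_ ?_ ?_ ?_ <;> intro j <;> simp only [l₁₁, l₁₂, l₂₁, l₂₂] <;> split_ifs with hj
      · rw [Valuation.map_zero]; exact zero_le
      · rw [Valuation.map_one]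
      · rw [Valuation.map_one]
      · rw [Valuation.map_neg]
        refine Valuation.map_sub_le _ (by rw [Valuation.map_one]) ?_
        rw [map_inv₀, inv_le_one₀ ((Valuation.pos_iff _).2 (ha j))]; exact (not_le.1 hj).le
      · rw [Valuation.map_neg, Valuation.map_one]
      · rw [Valuation.map_zero]; exact zero_le
      · exact Valuation.map_add_le _ hj (by rw [Valuation.map_one])
      · rw [Valuation.map_one]
  · -- `h = p k`
    rw [← map_mul, ← hhw, ← splitEquivD_apply F E c hcδ hδ v n hT₀ hT₀d hJD w hw h]
    exact (ContinuousMulEquiv.symm_apply_apply _ _).symm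
  · -- `det_Δ(p_w) = det A(p_w)`
    rw [detDelta_eq_det_blkA F E c hcδ hδ hd v n hT₀ hJD hp w, blkA_eq_of_blkC_eq_zero hC, hmatW]
    simp only [Matrix.toBlocks_fromBlocks₁₁, Matrix.toBlocks_fromBlocks₁₂, diagonal_add, det_diagonal]
    refine Finset.prod_congr rfl fun j _ => ?_
    simp only [p₁₁, p₁₂]; split_ifs <;> ring
  · -- `c_*(det_Δ(p_{c⁻¹w})) · det D(p_w) = 1`
    have h1 := map_detDelta_galInv_mul_det_blkD F E c hcδ hδ hd v n hT₀ hT₀d hJD hp w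
    have hD : (blkD (matW F E c v n w (eD.symm Pgl))).det =
        ∏ j, (if ValuativeRel.valuation (w.1.adicCompletion E) (a j) ≤ 1 then 1 else a j) := by
      rw [hmatW, blkD]
      simp only [Matrix.toBlocks_fromBlocks₁₁, Matrix.toBlocks_fromBlocks₁₂, Matrix.toBlocks_fromBlocks₂₁, Matrix.toBlocks_fromBlocks₂₂,
        diagonal_add, diagonal_sub, ← diagonal_smul, det_diagonal]
      refine Finset.prod_congr rfl fun j _ => ?_
      simp only [Pi.smul_apply, smul_eq_mul, p₁₁, p₁₂, p₂₁, p₂₂, invOf_eq_inv]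
      split_ifs <;> ring
    rw [hD] at h1
    exact eq_inv_of_mul_eq_one_left h1

end Summit.HodgeConjecture.HodgeConjecture.Cruxes.HLiu418.K2LiuSplitCartanIwasawaGL

end
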